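import Summits.NavierStokesRegularity.NavierStokesRegularity.Theorems.PalasekTowerBreakdownEpisodeBaseSliceExplicit
import Summits.NavierStokesRegularity.FluidComputer.PalasekTowerGermHostShadowedRun
import Summits.NavierStokesRegularity.FluidComputer.PalasekTowerGermHostNearFreeRun

/-!
# Route `PalasekTowerBreakdown`, crux `EpisodeBase` (stmt-NavierStokesRegularity-19179), line `slot` v5:
# `EpisodeBase` FROM AN EXPLICIT GERM DESIGN AND ONE APPROXIMATE FREE RUN WITH A CERTIFIED REMAINDER AND
# EXPLICIT MARGINS (the shadowed-run / a-posteriori door, by name)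

Cell `ns-blowup`, seat `ns-blowup-fc-prover-3` (g9; D-0074 GROUP C «BRIDGE SUPPORT»; `--supports
stmt-NavierStokesRegularity-19179`). LABEL: E–C typing (KERNEL; theorems only, no definition, no named
fact, no `sorry`). WHAT THIS IS NOT: not Navier–Stokes evidence — no approximate run meeting the letter is
exhibited anywhere; the route decl `EpisodeBase` is concluded ONLY from the hypotheses displayed. Nothing
about `RungG 1`, `EpisodeInduction` or blow-up.

The registered stub `stub_explicit_slice_run : ExplicitSliceRun` (holder's `Cruxes/EpisodeBase/Lines/slot.lean`
v5) asks for an explicit germ design and ONE classical finite-energy run on the first growth window meeting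
the level-`1` letter. The free-run door of record (`palasekTowerBreakdown_episodeBase_of_lineGerm_freeRun`,
p498380) takes an EXACT free run with margins; this file takes what a certificate can actually deliver — an
APPROXIMATE free run `w` on the window clock `[0, w₀]` with a certified defect (`F` in the Oseen identity, or
a residual force `r` of a classical pseudo-solution), a datum gap `D = sup ‖U − w(0)‖`, a shadowing radius
`δ ≥ 2 (D + F) e^{36 C₀² (2M+1)² w₀}`, `δ ≤ 1/2`, and the four faces read on `w` with margins `η + δ` (strain by
a finite difference) — and concludes `EpisodeBase` (FluidComputer door
`Germ.LineGermData.exists_sliceRun_of_shadowedRun` / `_of_pseudoRun` composed with ecbridge-4 g5's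
`palasekTowerBreakdown_episodeBase_of_exists_lineGerm_selfRun`, p472431).

THE PRICE (kernel, `PalasekTowerGermHostShadowedRun` §3): a reference meeting the speed face has `M ≥ Y₁`,
so the hypothesis forces `2 (D + F) e^{36 · 5508 · C₀²} ≤ 1/2` (`Germ.defect_le_of_door_hypothesis`;
`C₀ = oseenSliceConst ℝ³`, a `Classical.choose` constant of the tree with no explicit value today); the
window is `A₀ w₀ ∈ (61.72, 61.74)` level-`0` strain times long (`Germ.strainClock_window_zero_bounds`). The
certificate road to the base episode through sup-norm shadowing is thereby PRICED, not opened.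

References: M. Dashti, J. C. Robinson, SIAM J. Numer. Anal. 46 (2008) [cite: DashtiRobinson2008, Thm. 5];
S. I. Chernyshenko, P. Constantin, J. C. Robinson, E. S. Titi, J. Math. Phys. 48 (2007) 065204
[cite: ChernyshenkoConstantinRobinsonTiti2007, Thm. 2]; T. Tao, Anal. PDE 6 (2013) Thm. 5.4
[cite: Tao2011, Thm. 5.4 (ii)+(iv)]; S. Palasek, arXiv:2605.13827 §4 [cite: Palasek2026ElementaryModel, §4].
-/

noncomputable section

namespace Summit.NavierStokesRegularity.NavierStokesRegularity.Theorems

open Set Function MeasureTheory Metric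
open scoped ENNReal
open Summit.NavierStokesRegularity.NavierStokesRegularity.Theses
open Summit.NavierStokesRegularity.FluidComputer.PalasekTowerClayBridge
open Summit.NavierStokesRegularity.FluidComputer.PalasekTowerClayBridge.Germ
open Literature.Analysis Literature.Analysis.FluidPDE

/-- **`EpisodeBase` FROM AN EXPLICIT GERM DESIGN AND ONE APPROXIMATE FREE RUN (mild-level reference).**
`d : LineGermData U ρ σ₀ ε₀ c₄`; a field `w` on the window clock `[0, w₀]` (`w₀ = Host.wfirst`) with continuous
slices, jointly measurable on the open slab, `‖w‖ ≤ M` (`M > 0`), obeying the Oseen integral identity at unit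
viscosity up to `‖Φ‖ ≤ F` (`F ≥ 0`); `‖U − w(0)‖ ≤ D`; `2 (D + F) exp (36 C₀² (M+(M+1))² w₀) ≤ δ ≤ 1/2`; `η > 0`;
and on `w`: cap `≤ (5/3) Y₁ − η − δ`, speed `≥ Y₁ + η + δ` at some `‖x‖ ≤ ρ` at `w₀`, finite-difference strain
`(A₁ + η) ‖x₁ − x₀‖ + 2δ < ‖w(w₀,x₁) − w(w₀,x₀)‖` with `x₀, x₁ ∈ B̄(0, ρ)`, and an `N₁`-core loop of circulation
`≥ N₁^{β−2} + η + δ · 8π/N₁` ⟹ `EpisodeBase`. [cite: DashtiRobinson2008, Thm. 5]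
[cite: Palasek2026ElementaryModel, §4] [cite: Tao2011, Thm. 5.4 (ii)+(iv)] -/
theorem palasekTowerBreakdown_episodeBase_of_lineGerm_shadowedRun
    {U : EuclideanSpace ℝ (Fin 3) → EuclideanSpace ℝ (Fin 3)} {ρ σ₀ ε₀ c₄ : ℝ} (d : LineGermData U ρ σ₀ ε₀ c₄)
    {w Φ : ℝ → EuclideanSpace ℝ (Fin 3) → EuclideanSpace ℝ (Fin 3)} {M F D δ η : ℝ}
    (hslc : ∀ s ∈ Icc 0 Host.wfirst, Continuous (w s))
    (hmeas : AEStronglyMeasurable (uncurry w)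
      ((volume : Measure (ℝ × EuclideanSpace ℝ (Fin 3))).restrict (Ioo 0 Host.wfirst ×ˢ univ)))
    (hM : 0 < M) (hbd : ∀ s ∈ Icc 0 Host.wfirst, ∀ y, ‖w s y‖ ≤ M)
    (hrep : ∀ s ∈ Ioc 0 Host.wfirst, w s =ᵐ[volume] fun x =>
      UnboundedOperators.heatExtension (w 0) (1 * s) x - oseenDuhamel 1 0 w w s x + Φ s x)
    (hF0 : 0 ≤ F) (hF : ∀ s ∈ Ioc 0 Host.wfirst, ∀ x, ‖Φ s x‖ ≤ F)
    (hD : ∀ y, ‖U y - w 0 y‖ ≤ D)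
    (hδ : 2 * (D + F) *
      Real.exp (36 * oseenSliceConst (EuclideanSpace ℝ (Fin 3)) ^ 2 * (M + (M + 1)) ^ 2 / 1 * Host.wfirst) ≤ δ)
    (hδ2 : δ ≤ 1 / 2) (hη : 0 < η)
    (hcap : ∀ s ∈ Icc 0 Host.wfirst, ∀ x, ‖w s x‖ ≤ 5 / 3 * TowerRates.wide.Y 1 - η - δ)
    (hspeed : ∃ x, ‖x‖ ≤ ρ ∧ TowerRates.wide.Y 1 + η + δ ≤ ‖w Host.wfirst x‖)
    (hstrain : ∃ x₀ x₁, ‖x₀‖ ≤ ρ ∧ ‖x₁‖ ≤ ρ ∧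
      (TowerRates.wide.A 1 + η) * ‖x₁ - x₀‖ + 2 * δ < ‖w Host.wfirst x₁ - w Host.wfirst x₀‖)
    (hcore : ∃ (x : EuclideanSpace ℝ (Fin 3)) (γ : ℝ → EuclideanSpace ℝ (Fin 3)),
      ‖x‖ ≤ ρ ∧ ContDiff ℝ 1 γ ∧ γ 0 = γ 1 ∧
      (∀ s ∈ Icc (0 : ℝ) 1, γ s ∈ closedBall x (1 / TowerRates.wide.N 1)) ∧
      (∀ s ∈ Icc (0 : ℝ) 1, ‖deriv γ s‖ ≤ 8 * Real.pi / TowerRates.wide.N 1) ∧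
      TowerRates.wide.N 1 ^ (TowerRates.wide.β - 2) + η + δ * (8 * Real.pi / TowerRates.wide.N 1) ≤
        circulation (w Host.wfirst) γ) :
    PalasekTowerBreakdown.EpisodeBase :=
  palasekTowerBreakdown_episodeBase_of_exists_lineGerm_selfRun
    (d.exists_sliceRun_of_shadowedRun hslc hmeas hM hbd hrep hF0 hF hD hδ hδ2 hη hcap hspeed hstrain hcore)

/-- **`EpisodeBase` FROM AN EXPLICIT GERM DESIGN AND ONE CLASSICAL PSEUDO-SOLUTION WITH ITS RESIDUAL
(a-posteriori form).** `d : LineGermData U ρ σ₀ ε₀ c₄`; a classical solution `(w, ϖ)` on the window clock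
`[0, w₀]` at unit viscosity FORCED BY `r` (its residual as a free run: jointly continuous, bounded, weakly
divergence-free slices, `‖r(s)‖₂ ≤ G`), finite energy, `‖w‖ ≤ M`; `‖U − w(0)‖ ≤ D`;
`2 (D + 4 w₀^{1/4} G) exp (36 C₀² (M+(M+1))² w₀) ≤ δ ≤ 1/2`; `η > 0`; and the four faces read on `w` with margins
`η, δ` (strain by a finite difference) ⟹ `EpisodeBase`. [cite: DashtiRobinson2008, Thm. 5]
[cite: ChernyshenkoConstantinRobinsonTiti2007, Thm. 2] [cite: Palasek2026ElementaryModel, §4] -/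
theorem palasekTowerBreakdown_episodeBase_of_lineGerm_pseudoRun
    {U : EuclideanSpace ℝ (Fin 3) → EuclideanSpace ℝ (Fin 3)} {ρ σ₀ ε₀ c₄ : ℝ} (d : LineGermData U ρ σ₀ ε₀ c₄)
    {w r : ℝ → EuclideanSpace ℝ (Fin 3) → EuclideanSpace ℝ (Fin 3)} {ϖ : ℝ → EuclideanSpace ℝ (Fin 3) → ℝ}
    {M G R D δ η : ℝ}
    (hw : IsClassicalNSSolutionOn (Icc 0 Host.wfirst) 1 r w ϖ)
    (hwE : ∃ C : ℝ≥0∞, C < ⊤ ∧ ∀ s ∈ Icc 0 Host.wfirst, ∫⁻ x, ‖w s x‖ₑ ^ 2 ≤ C)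
    (hM : 0 < M) (hbd : ∀ s ∈ Icc 0 Host.wfirst, ∀ y, ‖w s y‖ ≤ M)
    (hrc : Continuous (uncurry r)) (hR : ∀ s ∈ Icc 0 Host.wfirst, ∀ y, ‖r s y‖ ≤ R)
    (hrdiv : ∀ s ∈ Icc 0 Host.wfirst, IsWeaklyDivFree (r s))
    (hG : 0 ≤ G) (hr2 : ∀ s ∈ Icc 0 Host.wfirst, eLpNorm (r s) 2 volume ≤ ENNReal.ofReal G)
    (hD : ∀ y, ‖U y - w 0 y‖ ≤ D)
    (hδ : 2 * (D + 4 * (1 : ℝ) ^ (-(3 / 4 : ℝ)) * Host.wfirst ^ (1 / 4 : ℝ) * G) *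
      Real.exp (36 * oseenSliceConst (EuclideanSpace ℝ (Fin 3)) ^ 2 * (M + (M + 1)) ^ 2 / 1 * Host.wfirst) ≤ δ)
    (hδ2 : δ ≤ 1 / 2) (hη : 0 < η)
    (hcap : ∀ s ∈ Icc 0 Host.wfirst, ∀ x, ‖w s x‖ ≤ 5 / 3 * TowerRates.wide.Y 1 - η - δ)
    (hspeed : ∃ x, ‖x‖ ≤ ρ ∧ TowerRates.wide.Y 1 + η + δ ≤ ‖w Host.wfirst x‖)
    (hstrain : ∃ x₀ x₁, ‖x₀‖ ≤ ρ ∧ ‖x₁‖ ≤ ρ ∧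
      (TowerRates.wide.A 1 + η) * ‖x₁ - x₀‖ + 2 * δ < ‖w Host.wfirst x₁ - w Host.wfirst x₀‖)
    (hcore : ∃ (x : EuclideanSpace ℝ (Fin 3)) (γ : ℝ → EuclideanSpace ℝ (Fin 3)),
      ‖x‖ ≤ ρ ∧ ContDiff ℝ 1 γ ∧ γ 0 = γ 1 ∧
      (∀ s ∈ Icc (0 : ℝ) 1, γ s ∈ closedBall x (1 / TowerRates.wide.N 1)) ∧
      (∀ s ∈ Icc (0 : ℝ) 1, ‖deriv γ s‖ ≤ 8 * Real.pi / TowerRates.wide.N 1) ∧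
      TowerRates.wide.N 1 ^ (TowerRates.wide.β - 2) + η + δ * (8 * Real.pi / TowerRates.wide.N 1) ≤
        circulation (w Host.wfirst) γ) :
    PalasekTowerBreakdown.EpisodeBase :=
  palasekTowerBreakdown_episodeBase_of_exists_lineGerm_selfRun
    (d.exists_sliceRun_of_pseudoRun hw hwE hM hbd hrc hR hrdiv hG hr2 hD hδ hδ2 hη hcap hspeed hstrain hcore)

/-- **`EpisodeBase` FROM ANY STRICT-SLOT FILLER AND ONE APPROXIMATE FREE RUN** (the certificate's Step A
object `Germ.LevelZeroData U ρ` of ecbridge-3's CERTIFICATE-INTERFACE, no explicit `(σ₀, ε, c₄)` needed: the strict slot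
yields SOME explicit line-germ design, `LevelZeroData.lineGermData`, and the mild-level shadowed-run door applies to it).
[cite: DashtiRobinson2008, Thm. 5] [cite: Palasek2026ElementaryModel, §4] -/
theorem palasekTowerBreakdown_episodeBase_of_levelZeroData_shadowedRun
    {U : EuclideanSpace ℝ (Fin 3) → EuclideanSpace ℝ (Fin 3)} {ρ : ℝ} (h : LevelZeroData U ρ)
    {w Φ : ℝ → EuclideanSpace ℝ (Fin 3) → EuclideanSpace ℝ (Fin 3)} {M F D δ η : ℝ}
    (hslc : ∀ s ∈ Icc 0 Host.wfirst, Continuous (w s))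
    (hmeas : AEStronglyMeasurable (uncurry w)
      ((volume : Measure (ℝ × EuclideanSpace ℝ (Fin 3))).restrict (Ioo 0 Host.wfirst ×ˢ univ)))
    (hM : 0 < M) (hbd : ∀ s ∈ Icc 0 Host.wfirst, ∀ y, ‖w s y‖ ≤ M)
    (hrep : ∀ s ∈ Ioc 0 Host.wfirst, w s =ᵐ[volume] fun x =>
      UnboundedOperators.heatExtension (w 0) (1 * s) x - oseenDuhamel 1 0 w w s x + Φ s x)
    (hF0 : 0 ≤ F) (hF : ∀ s ∈ Ioc 0 Host.wfirst, ∀ x, ‖Φ s x‖ ≤ F)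
    (hD : ∀ y, ‖U y - w 0 y‖ ≤ D)
    (hδ : 2 * (D + F) *
      Real.exp (36 * oseenSliceConst (EuclideanSpace ℝ (Fin 3)) ^ 2 * (M + (M + 1)) ^ 2 / 1 * Host.wfirst) ≤ δ)
    (hδ2 : δ ≤ 1 / 2) (hη : 0 < η)
    (hcap : ∀ s ∈ Icc 0 Host.wfirst, ∀ x, ‖w s x‖ ≤ 5 / 3 * TowerRates.wide.Y 1 - η - δ)
    (hspeed : ∃ x, ‖x‖ ≤ ρ ∧ TowerRates.wide.Y 1 + η + δ ≤ ‖w Host.wfirst x‖)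
    (hstrain : ∃ x₀ x₁, ‖x₀‖ ≤ ρ ∧ ‖x₁‖ ≤ ρ ∧
      (TowerRates.wide.A 1 + η) * ‖x₁ - x₀‖ + 2 * δ < ‖w Host.wfirst x₁ - w Host.wfirst x₀‖)
    (hcore : ∃ (x : EuclideanSpace ℝ (Fin 3)) (γ : ℝ → EuclideanSpace ℝ (Fin 3)),
      ‖x‖ ≤ ρ ∧ ContDiff ℝ 1 γ ∧ γ 0 = γ 1 ∧
      (∀ s ∈ Icc (0 : ℝ) 1, γ s ∈ closedBall x (1 / TowerRates.wide.N 1)) ∧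
      (∀ s ∈ Icc (0 : ℝ) 1, ‖deriv γ s‖ ≤ 8 * Real.pi / TowerRates.wide.N 1) ∧
      TowerRates.wide.N 1 ^ (TowerRates.wide.β - 2) + η + δ * (8 * Real.pi / TowerRates.wide.N 1) ≤
        circulation (w Host.wfirst) γ) :
    PalasekTowerBreakdown.EpisodeBase :=
  palasekTowerBreakdown_episodeBase_of_lineGerm_shadowedRun (h.lineGermData one_pos le_rfl) hslc hmeas hM hbd
    hrep hF0 hF hD hδ hδ2 hη hcap hspeed hstrain hcore

/-- **`EpisodeBase` FROM THE SHADOWED-RUN LETTER** (∃-packaged; the shape a skeleton would register as a stub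
`stub_explicit_shadowed_run` — what a CERTIFICATE of the base episode would literally file): SOME explicit germ design
`(U, ρ, σ₀, ε₀, c₄)` with `Germ.LineGermData`, SOME field `w` on the window clock `[0, w₀] × ℝ³` with continuous slices,
jointly measurable, bounded by `M > 0`, obeying the Oseen identity at unit viscosity up to a remainder of size `F ≥ 0`,
SOME datum gap `D ≥ ‖U − w(0)‖`, SOME `δ` with `2 (D + F) e^{36 C₀² (M+(M+1))² w₀} ≤ δ ≤ 1/2`, SOME margin `η > 0`, and the
four explicit readouts of `w` (cap, speed, finite-difference strain, core) with margins `η, δ` ⟹ `EpisodeBase`.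
[cite: DashtiRobinson2008, Thm. 5] [cite: Palasek2026ElementaryModel, §4] [cite: Tao2011, Thm. 5.4 (ii)+(iv)] -/
theorem palasekTowerBreakdown_episodeBase_of_exists_lineGerm_shadowedRun
    (hex : ∃ (U : EuclideanSpace ℝ (Fin 3) → EuclideanSpace ℝ (Fin 3)) (ρ σ₀ ε₀ c₄ : ℝ)
      (_ : LineGermData U ρ σ₀ ε₀ c₄)
      (w Φ : ℝ → EuclideanSpace ℝ (Fin 3) → EuclideanSpace ℝ (Fin 3)) (M F D δ η : ℝ),
      (∀ s ∈ Icc 0 Host.wfirst, Continuous (w s)) ∧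
      AEStronglyMeasurable (uncurry w)
        ((volume : Measure (ℝ × EuclideanSpace ℝ (Fin 3))).restrict (Ioo 0 Host.wfirst ×ˢ univ)) ∧
      0 < M ∧ (∀ s ∈ Icc 0 Host.wfirst, ∀ y, ‖w s y‖ ≤ M) ∧
      (∀ s ∈ Ioc 0 Host.wfirst, w s =ᵐ[volume] fun x =>
        UnboundedOperators.heatExtension (w 0) (1 * s) x - oseenDuhamel 1 0 w w s x + Φ s x) ∧
      0 ≤ F ∧ (∀ s ∈ Ioc 0 Host.wfirst, ∀ x, ‖Φ s x‖ ≤ F) ∧ (∀ y, ‖U y - w 0 y‖ ≤ D) ∧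
      2 * (D + F) *
          Real.exp (36 * oseenSliceConst (EuclideanSpace ℝ (Fin 3)) ^ 2 * (M + (M + 1)) ^ 2 / 1 * Host.wfirst) ≤
        δ ∧ δ ≤ 1 / 2 ∧ 0 < η ∧
      (∀ s ∈ Icc 0 Host.wfirst, ∀ x, ‖w s x‖ ≤ 5 / 3 * TowerRates.wide.Y 1 - η - δ) ∧
      (∃ x, ‖x‖ ≤ ρ ∧ TowerRates.wide.Y 1 + η + δ ≤ ‖w Host.wfirst x‖) ∧
      (∃ x₀ x₁, ‖x₀‖ ≤ ρ ∧ ‖x₁‖ ≤ ρ ∧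
        (TowerRates.wide.A 1 + η) * ‖x₁ - x₀‖ + 2 * δ < ‖w Host.wfirst x₁ - w Host.wfirst x₀‖) ∧
      (∃ (x : EuclideanSpace ℝ (Fin 3)) (γ : ℝ → EuclideanSpace ℝ (Fin 3)),
        ‖x‖ ≤ ρ ∧ ContDiff ℝ 1 γ ∧ γ 0 = γ 1 ∧
        (∀ s ∈ Icc (0 : ℝ) 1, γ s ∈ closedBall x (1 / TowerRates.wide.N 1)) ∧
        (∀ s ∈ Icc (0 : ℝ) 1, ‖deriv γ s‖ ≤ 8 * Real.pi / TowerRates.wide.N 1) ∧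
        TowerRates.wide.N 1 ^ (TowerRates.wide.β - 2) + η + δ * (8 * Real.pi / TowerRates.wide.N 1) ≤
          circulation (w Host.wfirst) γ)) :
    PalasekTowerBreakdown.EpisodeBase := by
  obtain ⟨U, ρ, σ₀, ε₀, c₄, d, w, Φ, M, F, D, δ, η, hslc, hmeas, hM, hbd, hrep, hF0, hF, hD, hδ, hδ2, hη,
    hcap, hspeed, hstrain, hcore⟩ := hex
  exact palasekTowerBreakdown_episodeBase_of_lineGerm_shadowedRun d hslc hmeas hM hbd hrep hF0 hF hD hδ hδ2 hη
    hcap hspeed hstrain hcore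

/-- **`EpisodeBase` FROM AN EXPLICIT GERM DESIGN, AN EXACT FREE RUN IN ANY CURRENCY, AND A `δ`-CLOSE FIELD
WITH THE FOUR EXPLICIT READOUTS** (the certificate-side letter, currency-free; refuter4 K167 (R3)):
`d : LineGermData U ρ σ₀ ε₀ c₄`; an EXACT classical finite-energy free run `(v, q)` on `[1, Host.τfirst]` from `v 1 = U`
(its existence supplied by the caller: sup-norm shadowing, an energy-class a-posteriori theory, a Newton–Kantorovich
enclosure, or a construction); a field `w` with `‖v − w‖ ≤ δ` on the window and `w(τfirst)` continuous; `η > 0`; and on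
`w`: cap `≤ (5/3)Y₁ − η − δ`, speed `≥ Y₁ + η + δ` at some `‖x‖ ≤ ρ`, finite-difference strain
`(A₁+η)‖x₁ − x₀‖ + 2δ < ‖w(τfirst,x₁) − w(τfirst,x₀)‖` (`x₀, x₁ ∈ B̄(0,ρ)`), core circulation `≥ N₁^{β−2} + η + δ·8π/N₁`
⟹ `EpisodeBase` (`Germ.LineGermData.exists_sliceRun_of_near_freeRun` ∘ p472431).
[cite: Palasek2026ElementaryModel, §4] [cite: Tao2011, Thm. 5.4 (ii)+(iv)] -/
theorem palasekTowerBreakdown_episodeBase_of_lineGerm_nearFreeRun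
    {U : EuclideanSpace ℝ (Fin 3) → EuclideanSpace ℝ (Fin 3)} {ρ σ₀ ε₀ c₄ : ℝ} (d : LineGermData U ρ σ₀ ε₀ c₄)
    {v w : ℝ → EuclideanSpace ℝ (Fin 3) → EuclideanSpace ℝ (Fin 3)} {q : ℝ → EuclideanSpace ℝ (Fin 3) → ℝ}
    {δ η : ℝ}
    (hv : IsClassicalNSSolutionOn (Icc 1 Host.τfirst) 1 0 v q) (hv1 : v 1 = U)
    (hvE : ∃ C : ℝ≥0∞, C < ⊤ ∧ ∀ t ∈ Icc (1 : ℝ) Host.τfirst, ∫⁻ x, ‖v t x‖ₑ ^ 2 ≤ C)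
    (hnear : ∀ t ∈ Icc (1 : ℝ) Host.τfirst, ∀ x, ‖v t x - w t x‖ ≤ δ)
    (hwc : Continuous (w Host.τfirst)) (hη : 0 < η)
    (hcap : ∀ t ∈ Icc (1 : ℝ) Host.τfirst, ∀ x, ‖w t x‖ ≤ 5 / 3 * TowerRates.wide.Y 1 - η - δ)
    (hspeed : ∃ x, ‖x‖ ≤ ρ ∧ TowerRates.wide.Y 1 + η + δ ≤ ‖w Host.τfirst x‖)
    (hstrain : ∃ x₀ x₁, ‖x₀‖ ≤ ρ ∧ ‖x₁‖ ≤ ρ ∧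
      (TowerRates.wide.A 1 + η) * ‖x₁ - x₀‖ + 2 * δ < ‖w Host.τfirst x₁ - w Host.τfirst x₀‖)
    (hcore : ∃ (x : EuclideanSpace ℝ (Fin 3)) (γ : ℝ → EuclideanSpace ℝ (Fin 3)),
      ‖x‖ ≤ ρ ∧ ContDiff ℝ 1 γ ∧ γ 0 = γ 1 ∧
      (∀ s ∈ Icc (0 : ℝ) 1, γ s ∈ closedBall x (1 / TowerRates.wide.N 1)) ∧
      (∀ s ∈ Icc (0 : ℝ) 1, ‖deriv γ s‖ ≤ 8 * Real.pi / TowerRates.wide.N 1) ∧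
      TowerRates.wide.N 1 ^ (TowerRates.wide.β - 2) + η + δ * (8 * Real.pi / TowerRates.wide.N 1) ≤
        circulation (w Host.τfirst) γ) :
    PalasekTowerBreakdown.EpisodeBase :=
  palasekTowerBreakdown_episodeBase_of_exists_lineGerm_selfRun
    (d.exists_sliceRun_of_near_freeRun hv hv1 hvE hnear hwc hη hcap hspeed hstrain hcore)

end Summit.NavierStokesRegularity.NavierStokesRegularity.Theorems

end
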